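import Summits.AtomisticToContinuum.HydrodynamicLimit.Theorems.InformationPercolationEnginePercolationClosesChaosForecastRetyped
import Summits.AtomisticToContinuum.HydrodynamicLimit.Theorems.InformationPercolationEnginePercolationClosesChaosForecastTransferArch
import Summits.AtomisticToContinuum.HydrodynamicLimit.Theorems.InformationPercolationEnginePercolationClosesChaosDockingCells
import HarnessLib

/-!
# Vocabulary of the line `equilibrium-forecast-chain-rule` for the crux `InformationPercolationEngine.PercolationClosesChaos`
(stmt-AtomisticToContinuum-15178) — part 4: the ROBUST re-typing of skeleton v9 (lead c4, line cycle 5)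

Definitions-only support file (`--supports stmt-AtomisticToContinuum-15178`), companion of `…ForecastDefs` (objects), `…ForecastStatements`
(v2), `…ForecastRetyped` (v5) and `…ForecastTransferArch` (H1–H5). Nothing is asserted: every `def` is a predicate the registered stubs of
skeleton v9 prove or consume.

## Why v9 (lead report c4)

`MesoStaticMaxwellRarity` (S2.2 of v5–v8) is TRUE ONLY BY A `log N` MARGIN. Its cheapest violation under the invariant law `G_N` is
COLLISION-FREE: a dilute slab of volume fraction `f` filled with two RIGID counter-streaming sheet lattices (velocities `±u x̂` up to a
rigidity precision `α`, sheets of width `h/4` parallel to the motion, `m₁ ≥ m₀` spheres per kinetic cell). Every core cell of the slab is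
`Regular` (`inhom = 0`), populated, and `≈ 2.66`-nat non-Maxwellian (`u = 1.5`, `ϑs = 0.3`) at EVERY step, no collision ever happens in
it, and its `G_N`-cost is `(N+1)[log(1/(1−f)) + f(m₁/n̄)(3 log(1/α) + u²/2 + O(1))]` with `α ≍ h m₁^{-1/3}/τ ∝ N^{-1/3}` — rate
`≈ f + f(m₁/n̄)·log N`, divergent only logarithmically (numerics: `0.24` at `N = 10⁹`, `1.26` at `N = 10¹²⁰` for `f = 0.2`,
`m₁/n̄ = 0.02`). All THERMALISING violations cost `∝ K_N ∝ N^{1/3}` (renewal; W5 red team), so the statement stands as typed, but a proof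
would have to be exact at the scale of the velocity-alignment entropy of collision-free sub-populations.

The transfer never needed those cells: they OWN NO COLLISION. In the per-unit split of `ForecastAlgebra` (iii) the non-good term
`T · 𝟙{occupied ∧ ¬Good}` can be replaced by the COLLISION-WEIGHTED `𝟙{occupied ∧ ¬Good} · Ĝ X̃ = Ĝ(𝟙{…} · X̃)` (pull-in) followed by
the forecast swap H1 — PROVIDED the indicator is REVEALED (a function of `seqHist k q`). The exact `GoodUnit` (exact velocities at `kΔ`)
is not revealed; its BINNED twin `GoodUnitB b` (velocities replaced by their bin centres; cells and bins of all spheres at `kΔ` ARE in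
`hist k`) is. With it the LG-side input becomes the WEIGHTED non-good mass `NonGoodRareW`, fed by the WEIGHTED local Maxwellianity
`CoarseLocalMaxwellianityW`, fed (static Cesàro transfer with weights `≤ T`, `exists_lgTransferConst` at `M = 27 T`) by the WEIGHTED
`G_N` statement `MesoStaticMaxwellRarityW` — whose cheapest violation must keep NON-MAXWELLIAN POPULATED CELLS COLLIDING at a
macroscopic rate for `K_N ∝ N^{1/3}` steps (renewal, or per-collision fine-tuning against the `ℓ/ε`-hyperbolicity of dispersing
collisions): rate `∝ N^{1/3}`, ROBUST, and STRICTLY WEAKER than S2.2 read on binned velocities (`𝟙 · min(ownedCount, T) ≤ T · 𝟙`).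
Price: the guard of `MesoForecastChaos` / `BadForecastRare` becomes `GoodUnitB b`, the bin width is quantified `∃ b₀ ∀ b ≤ b₀` after
`c` (for `b ≳ ϑs` binned functionals are meaningless), and `NoKineticIrregularity` reads `inhom` on binned velocities. `LocalCountUI`,
`NoMesoscopicOscillationR`, `RoughCollisionRare`, `RevealedDefectStability`, H1 `ForecastSwap`, H4 `RevealedSandwich`, the docking:
untouched.

## Contents

§R1 binned velocities (`binCentre`, `binConfig`, `GoodUnitB`); §R2 the observation-level twins of the coarse functionals (`popO`,
`nbhdO`, `velConfigO`, `DenseO`, `GoodO`), the step-start data read from the sequential history (`histData`) and the REVEALED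
NON-GOOD INDICATOR `Jng` (a function of `seqHist k q` by construction; equal on the good set to `𝟙{occupied ∧ ¬GoodUnitB}` —
the dictionary fact `JngSpec`, proved in `…ForecastRobustReveal`); §R3 the robust `G_N` statements `MesoForecastChaosB`, `MesoStaticMaxwellRarityW`; §R4 the LG-side
statements `CoarseLocalMaxwellianityW`, `NoKineticIrregularityB`; §R5 the re-typed hypotheses `BadForecastRareB` (H2_B),
`NonGoodRareW` (H3_W), `ForecastSplitW` (H5_W, the weighted split); §R6 pointwise sanity lemmas.

## The composition v9 is designed for (`kineticCellChaosLG_of_w`, file `…ForecastTransferArchW`)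

`m(bW_η) ≤ m(X̃)` (H5 i) `≤ m(Ĝ X̃) + ε` (H1) `≤ m(Ĝ(J·X̃)) + 27δ + T·m(𝟙{GoodB ∧ Ĝ bW_{η/2} > δ}) + m(Ĝ R) + ε` (H5_W.1 with
`J = Jng`) `≤ m(J·X̃) + m(R) + 3ε + 27δ + T δ₂` (H1 twice, H2_B) `≤ m(J·min(ownedCount, T)) + 2 m(R) + … ≤ δ₃ + 2δ₄ + 3ε + 27δ + Tδ₂`
(H5_W.2, H3_W, H4).
-/

noncomputable section

open MeasureTheory Set Filter Topology
open scoped ENNReal BigOperators Classical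
open Literature.Analysis.FluidPDE Literature.MathematicalPhysics.KineticTheory
open Literature.MathematicalPhysics.KineticTheory.VelocityBlindPlacement

namespace Summit.AtomisticToContinuum.HydrodynamicLimit.Theorems.EquilibriumForecastLine

/-! ## §R1 Binned velocities (revealed at every step start) -/

/-- Centre of the velocity bin `β` of width `b`: `((β_m + ½) b)_m`. -/
def binCentre (b : ℝ) (β : Cell) : V3 :=
  WithLp.toLp 2 fun m : Fin 3 => (((β m : ℤ) : ℝ) + 2⁻¹) * b

/-- The configuration with every velocity replaced by the centre of its bin (positions untouched): the coarse functionals of §3 of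
`…ForecastDefs` read on `binConfig b w` are functions of the cells and velocity bins of all spheres, i.e. of `obs`. -/
def binConfig {N : ℕ} (b : ℝ) (w : Phase N) : Phase N :=
  fun i => ((w i).1, binCentre b (velBin b (w i).2))

/-- Binning does not move spheres. [folklore] -/
@[simp] theorem binConfig_fst {N : ℕ} (b : ℝ) (w : Phase N) (i : Fin (N + 1)) : (binConfig b w i).1 = (w i).1 := rfl

/-- The binned velocity of sphere `i`. [folklore] -/
@[simp] theorem binConfig_snd {N : ℕ} (b : ℝ) (w : Phase N) (i : Fin (N + 1)) :
    (binConfig b w i).2 = binCentre b (velBin b (w i).2) := rfl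

/-- Binning does not change cell populations. [folklore] -/
@[simp] theorem pop_binConfig {N : ℕ} (b c σ : ℝ) (w : Phase N) (q : Cell) :
    pop c σ N (binConfig b w) q = pop c σ N w q := by
  simp [pop, binConfig]

/-- Binning does not change neighbourhood populations. [folklore] -/
@[simp] theorem nbhd_binConfig {N : ℕ} (b c σ : ℝ) (w : Phase N) (q : Cell) :
    nbhd c σ N (binConfig b w) q = nbhd c σ N w q := by
  simp [nbhd, binConfig]

/-- Binning does not change the packing predicate. [folklore] -/
@[simp] theorem dense_binConfig_iff {N : ℕ} (b φs c σ : ℝ) (w : Phase N) (q : Cell) :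
    Dense φs c σ N (binConfig b w) q ↔ Dense φs c σ N w q := by
  simp [Dense]

/-- **Binned GOOD unit**: `GoodUnit` read on bin-centre velocities — REVEALED by `hist k` (cells and bins of all spheres at `kΔ`),
which the exact `GoodUnit` is not. For `b ≪ ϑs` the two differ by an `O(b/ϑs)`-perturbation of the smoothed laws. -/
def GoodUnitB (b ϑs ϑ φs c σ : ℝ) (N : ℕ) (w : Phase N) (q : Cell) : Prop :=
  GoodUnit ϑs ϑ φs c σ N (binConfig b w) q

/-! ## §R2 Observation-level twins of the coarse functionals and the revealed non-good indicator -/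

/-- Population of cell `q` read from per-sphere (cell, velocity-bin) data. -/
def popO {N : ℕ} (o : Fin (N + 1) → Cell × Cell) (q : Cell) : Finset (Fin (N + 1)) :=
  Finset.univ.filter fun i => (o i).1 = q

/-- Population of the `4cℓ`-neighbourhood of `q` read from per-sphere (cell, velocity-bin) data (cell centres only, as in `nbhd`). -/
def nbhdO (c σ : ℝ) (N : ℕ) (o : Fin (N + 1) → Cell × Cell) (q : Cell) : Finset (Fin (N + 1)) :=
  Finset.univ.filter fun i =>
    Torus.euclidDist (cellCentre c σ N (o i).1) (cellCentre c σ N q) ≤ 4 * (c * meanFreePath σ N)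

/-- A configuration carrying the BIN-CENTRE velocities of the data (positions are a dummy `0`: the velocity functionals `kde`,
`meanVel`, `temp`, `relEnt`, `inhom` of `…ForecastDefs` read only the velocities of the members of the finsets they are given). -/
def velConfigO {N : ℕ} (b : ℝ) (o : Fin (N + 1) → Cell × Cell) : Phase N :=
  fun i => (0, binCentre b (o i).2)

/-- Packing predicate read from the data (same inequality as `Dense`, neighbourhood count from `nbhdO`). -/
def DenseO (φs c σ : ℝ) (N : ℕ) (o : Fin (N + 1) → Cell × Cell) (q : Cell) : Prop :=
  φs * (4 / 3 * Real.pi * (4 * (c * meanFreePath σ N)) ^ 3) <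
    ((nbhdO c σ N o q).card : ℝ) * (Real.pi / 6 * hsDiameter σ N ^ 3)

/-- Good-unit predicate read from the data: on the data `(cellOf xᵢ, velBin b vᵢ)ᵢ` of a configuration `w` it is `GoodUnitB b … w q`
(`goodO_iff_goodUnitB`, file `…ForecastRobustReveal`). -/
def GoodO (b ϑs ϑ φs c σ : ℝ) (N : ℕ) (o : Fin (N + 1) → Cell × Cell) (q : Cell) : Prop :=
  (¬ DenseO φs c σ N o q ∧ inhom ϑs (velConfigO b o) (popO o q) (nbhdO c σ N o q) ≤ ϑ) ∧
    relEnt ϑs (velConfigO b o) (popO o q) ≤ ϑ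

/-- The (cell, velocity-bin) data of all spheres at time `kΔ`, read from a sequential history (index `k` of its `hist k` component). -/
def histData {N k : ℕ} (H : (Fin (k + 1) → Fin (N + 1) → Obs N) × (Fin (N + 1) → Option (Obs N))) :
    Fin (N + 1) → Cell × Cell :=
  fun i => (H.1 (Fin.last k) i).1

/-- **The REVEALED NON-GOOD INDICATOR** `J (k, q)`: `1` iff, according to the data revealed in `seqHist b c σ N Φ k q`, cell `q` is
occupied at `kΔ` and NOT a binned-good unit; a function of `seqHist k q z` BY CONSTRUCTION (hence `σ(seqHist k q)`-measurable and
constant on the atoms of `seqHistLE k q`), and equal on `Φ.good` to `𝟙{pop q ≠ ∅ ∧ ¬ GoodUnitB b ϑs ϑ φs (Φ.flow (kΔ) z) q}`. -/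
def Jng (b ϑs ϑ φs c σ : ℝ) (N : ℕ) (Φ : Flow σ N) (k : ℕ) (q : Cell) (z : Phase N) : ℝ :=
  if (popO (histData (seqHist b c σ N Φ k q z)) q).Nonempty ∧
      ¬ GoodO b ϑs ϑ φs c σ N (histData (seqHist b c σ N Φ k q z)) q then 1 else 0

/-- `Jng` is an indicator. [folklore] -/
theorem Jng_eq_zero_or_one (b ϑs ϑ φs c σ : ℝ) (N : ℕ) (Φ : Flow σ N) (k : ℕ) (q : Cell) (z : Phase N) :
    Jng b ϑs ϑ φs c σ N Φ k q z = 0 ∨ Jng b ϑs ϑ φs c σ N Φ k q z = 1 := by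
  unfold Jng; split_ifs <;> simp

/-- `0 ≤ Jng ≤ 1`. [folklore] -/
theorem Jng_mem_Icc (b ϑs ϑ φs c σ : ℝ) (N : ℕ) (Φ : Flow σ N) (k : ℕ) (q : Cell) (z : Phase N) :
    Jng b ϑs ϑ φs c σ N Φ k q z ∈ Set.Icc (0 : ℝ) 1 := by
  unfold Jng; split_ifs <;> simp

/-- `Jng` factors through the sequential history: equal histories give equal indicators. [folklore] -/
theorem Jng_eq_of_seqHist_eq {b ϑs ϑ φs c σ : ℝ} {N : ℕ} {Φ : Flow σ N} {k : ℕ} {q : Cell} {z z' : Phase N}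
    (h : seqHist b c σ N Φ k q z = seqHist b c σ N Φ k q z') :
    Jng b ϑs ϑ φs c σ N Φ k q z = Jng b ϑs ϑ φs c σ N Φ k q z' := by
  unfold Jng; rw [h]

/-- `Jng` depends on the sequential history only through its `hist k` component, which `seqHistLE k q` shares: equal
`seqHistLE`-data give equal indicators (the revealedness H1 `ForecastSwap` asks of the families it swaps). [folklore] -/
theorem Jng_eq_of_seqHistLE_eq {b ϑs ϑ φs c σ : ℝ} {N : ℕ} {Φ : Flow σ N} {k : ℕ} {q : Cell} {z z' : Phase N}
    (h : seqHistLE b c σ N Φ k q z = seqHistLE b c σ N Φ k q z') :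
    Jng b ϑs ϑ φs c σ N Φ k q z = Jng b ϑs ϑ φs c σ N Φ k q z' := by
  have h1 : (seqHist b c σ N Φ k q z).1 = (seqHist b c σ N Φ k q z').1 := by
    have := congrArg Prod.fst h
    simpa [seqHistLE, seqHist] using this
  unfold Jng histData
  rw [h1]

/-- **`JngSpec`** — what the revealed indicator IS on the good set: for every flow, parameters, unit `(k, q)` and GOOD initial datum `z`,
`Jng b ϑs ϑ φs c σ N Φ k q z = 𝟙{pop q ≠ ∅ at kΔ ∧ ¬ GoodUnitB b ϑs ϑ φs (Φ.flow (kΔ) z) q}` (on `Φ.good` the observation `obs k`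
records the true cells and velocity bins, `popO ∘ histData ∘ seqHist = pop`, `nbhdO … = nbhd`, and the velocity functionals of
`velConfigO b` and of `binConfig b` agree member by member). A deterministic dictionary fact (proved in `…ForecastRobustReveal`),
stated as a `Prop` so that the files proving H3_W / H5_W can take it as an explicit hypothesis and land independently. -/
def JngSpec : Prop :=
  ∀ {σ : ℝ} {N : ℕ} (Φ : Flow σ N) (b ϑs ϑ φs c : ℝ) (k : ℕ) (q : Cell) (z : Phase N), z ∈ Φ.good →
    Jng b ϑs ϑ φs c σ N Φ k q z =
      if (pop c σ N (Φ.flow ((k : ℝ) * stepLen c σ N) z) q).Nonempty ∧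
          ¬ GoodUnitB b ϑs ϑ φs c σ N (Φ.flow ((k : ℝ) * stepLen c σ N) z) q then 1 else 0

/-- **Registered headline of this vocabulary file** (`jng_revealed`): the revealed non-good indicator is constant on the atoms of
the data revealed right after every unit — the revealedness H1 `ForecastSwap` asks of the families it swaps (restates
`Jng_eq_of_seqHistLE_eq` with all arguments explicit after the colon, the registered stub shape). -/
theorem jng_revealed : ∀ (b ϑs ϑ φs c σ : ℝ) (N : ℕ) (Φ : Flow σ N) (k : ℕ) (q : Cell) (z z' : Phase N), seqHistLE b c σ N Φ k q z = seqHistLE b c σ N Φ k q z' → Jng b ϑs ϑ φs c σ N Φ k q z = Jng b ϑs ϑ φs c σ N Φ k q z' :=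
  fun _ _ _ _ _ _ _ _ _ _ _ _ h => Jng_eq_of_seqHistLE_eq h

/-! ## §R3 The robust `G_N`-side statements -/

/-- **`MesoForecastChaosB`** — `MesoForecastChaos` with the BINNED good-unit guard and the bin width quantified `∃ b₀ ∀ b ≤ b₀`
after `c` (weaker than `∀ b`; for `b ≳ ϑs` the binned guard is meaningless). Content and audit history as for `MesoForecastChaos`
(W5's mechanisms are insensitive to an `O(b)` perturbation of velocities); robust (cheapest violation renewal-type, rate `∝ K_N`):
good weighty units have a bad `G_N`-FORECAST of their truncated one-step collision-defect weight only on a space-time density of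
units that is large-deviation rare under `G_N` at EVERY rate `L(N+1)` once `c ≥ c₀(L)`, `b ≤ b₀(c)`, `N ≥ N₀`. Crux-class (OPEN). -/
def MesoForecastChaosB : Prop :=
  ∃ φs : ℝ, 0 < φs ∧ ∃ σ₁ : ℝ, 0 < σ₁ ∧ ∀ σ : ℝ, 0 < σ → σ ≤ σ₁ → ∀ Φ : (N : ℕ) → Flow σ N, ∀ τ : ℝ, 0 < τ →
  ∀ Ψ : V3 × V3 × V3 → ℝ, Continuous Ψ → (∃ C : ℝ, ∀ p, |Ψ p| ≤ C) →
    ∀ ϑs η δ T δ' L : ℝ, 0 < ϑs → 0 < η → 0 < δ → 0 < T → 0 < δ' → 0 < L →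
    ∃ ϑ : ℝ, 0 < ϑ ∧ ∃ c₀ : ℝ, 0 < c₀ ∧ ∀ c : ℝ, c₀ ≤ c → ∃ b₀ : ℝ, 0 < b₀ ∧ ∀ b : ℝ, 0 < b → b ≤ b₀ →
    ∃ N₀ : ℕ, ∀ N : ℕ, N₀ ≤ N →
      eqLaw σ N (Φ N) {z | δ' < unitAvg c σ N τ fun k q =>
        if GoodUnitB b ϑs ϑ φs c σ N ((Φ N).flow ((k : ℝ) * stepLen c σ N) z) q ∧
            δ < MeasureTheory.condExp (MeasurableSpace.comap (seqHist b c σ N (Φ N) k q) ⊤) (eqLaw σ N (Φ N))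
              (badWeight Ψ η T c σ N (Φ N) k q) z
        then 1 else 0} ≤ ENNReal.ofReal (Real.exp (-(L * ((N : ℝ) + 1))))

/-- **`MesoStaticMaxwellRarityW`** — the COLLISION-WEIGHTED static Maxwell rarity (replaces `MesoStaticMaxwellRarity`, which is
true only by a `log N` margin — module docstring): under the INVARIANT law, the unit average of
`𝟙{q Regular (binned), populated (≥ m₀), ϑ-non-Maxwellian (binned) at kΔ} · min(ownedCount (k,q), T)` exceeds `δ'` only with
probability `≤ e^{−L(N+1)}`, every rate `L`, for `c ≥ c₀(L, …)`, `b ≤ b₀(c, …)`, `N ≥ N₀`. Collision-free non-Maxwellian structures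
(rigid streams) weigh NOTHING here; a violation must keep non-Maxwellian populated cells COLLIDING at a macroscopic rate over
`K_N ∝ N^{1/3}` steps — renewal or per-collision fine-tuning, rate `∝ N^{1/3}`: ROBUST, and exactly the large-deviation H-theorem
content (collisions ⇒ Maxwellisation) with nothing else. Strictly WEAKER than `MesoStaticMaxwellRarity` read on binned velocities
(`𝟙 · min(ownedCount, T) ≤ T · 𝟙`, `weighted_le_T_mul`). Crux-class (OPEN). -/
def MesoStaticMaxwellRarityW : Prop :=
  ∃ φs : ℝ, 0 < φs ∧ ∃ σ₁ : ℝ, 0 < σ₁ ∧ ∀ σ : ℝ, 0 < σ → σ ≤ σ₁ → ∀ Φ : (N : ℕ) → Flow σ N, ∀ τ : ℝ, 0 < τ →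
  ∀ ϑs ϑ δ' L T : ℝ, 0 < ϑs → 0 < ϑ → 0 < δ' → 0 < L → 0 < T →
    ∃ m₀ : ℕ, ∃ ϑh : ℝ, 0 < ϑh ∧ ∃ c₀ : ℝ, 0 < c₀ ∧ ∀ c : ℝ, c₀ ≤ c → ∃ b₀ : ℝ, 0 < b₀ ∧ ∀ b : ℝ, 0 < b → b ≤ b₀ →
    ∃ N₀ : ℕ, ∀ N : ℕ, N₀ ≤ N →
      eqLaw σ N (Φ N) {z | δ' < unitAvg c σ N τ fun k q =>
        (if Regular ϑs ϑh φs c σ N (binConfig b ((Φ N).flow ((k : ℝ) * stepLen c σ N) z)) q ∧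
            m₀ ≤ (pop c σ N ((Φ N).flow ((k : ℝ) * stepLen c σ N) z) q).card ∧
            ϑ ≤ relEnt ϑs (binConfig b ((Φ N).flow ((k : ℝ) * stepLen c σ N) z))
              (pop c σ N ((Φ N).flow ((k : ℝ) * stepLen c σ N) z) q) then (1 : ℝ) else 0) *
          min (ownedCount c σ N (Φ N) k q z) T}
        ≤ ENNReal.ofReal (Real.exp (-(L * ((N : ℝ) + 1))))

/-! ## §R4 The LG-side statements the weighted transfer consumes -/

/-- **`CoarseLocalMaxwellianityW`** — COLLISION-WEIGHTED local equilibrium of the evolved law at the kinetic-cell scale: the `LG`-mean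
of the unit average of `𝟙{occupied ∧ ϑ < relEnt (binned) at kΔ} · min(ownedCount (k,q), T)` is `≤ δ` (derived in v9 from
`MesoStaticMaxwellRarityW`, `LocalCountUI` (ii) and `NoKineticIrregularityB` by the static Cesàro assembly with weights `≤ T`;
or FILED directly — weaker than `CoarseLocalMaxwellianity` read on binned velocities). -/
def CoarseLocalMaxwellianityW : Prop :=
  ∀ (a₀ θ₀ : T3 → ℝ) (u₀ : T3 → V3), Continuous a₀ → Continuous θ₀ → Continuous u₀ →
    (∀ x, 0 < a₀ x) → (∀ x, 0 < θ₀ x) →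
  ∃ σ₀ : ℝ, 0 < σ₀ ∧ ∀ σ : ℝ, 0 < σ → σ < σ₀ → ∀ Φ : (N : ℕ) → Flow σ N, ∀ τ : ℝ, 0 < τ →
  ∀ ϑs ϑ δ T : ℝ, 0 < ϑs → 0 < ϑ → 0 < δ → 0 < T →
    ∃ c₀ : ℝ, 0 < c₀ ∧ ∀ c : ℝ, c₀ ≤ c → ∃ b₀ : ℝ, 0 < b₀ ∧ ∀ b : ℝ, 0 < b → b ≤ b₀ → ∃ N₀ : ℕ, ∀ N : ℕ, N₀ ≤ N →
    ∫⁻ z, ENNReal.ofReal (unitAvg c σ N τ fun k q =>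
        (if (pop c σ N ((Φ N).flow ((k : ℝ) * stepLen c σ N) z) q).Nonempty ∧
            ϑ < relEnt ϑs (binConfig b ((Φ N).flow ((k : ℝ) * stepLen c σ N) z))
              (pop c σ N ((Φ N).flow ((k : ℝ) * stepLen c σ N) z) q) then (1 : ℝ) else 0) *
          min (ownedCount c σ N (Φ N) k q z) T)
      ∂(localGibbsLaw σ a₀ u₀ θ₀ N (Φ N)) ≤ ENNReal.ofReal δ

/-- **`NoKineticIrregularityB`** — `NoKineticIrregularity` with the inhomogeneity read on BINNED velocities (bin width `∃ b₀ ∀ b ≤ b₀`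
after `c`); same class and content (an `O(b/ϑs)` perturbation of `inhom`): actual kinetic cells with a populated `4cℓ`-neighbourhood
that are `ϑ`-inhomogeneous (binned smoothed laws of cell vs neighbourhood; kinetic VOIDS count) or occupied by fewer than `m₀` spheres
are rare in `LG`-mean. Item-class LG-side regularity input. -/
def NoKineticIrregularityB : Prop :=
  ∀ (a₀ θ₀ : T3 → ℝ) (u₀ : T3 → V3), Continuous a₀ → Continuous θ₀ → Continuous u₀ →
    (∀ x, 0 < a₀ x) → (∀ x, 0 < θ₀ x) →
  ∃ σ₀ : ℝ, 0 < σ₀ ∧ ∀ σ : ℝ, 0 < σ → σ < σ₀ → ∀ Φ : (N : ℕ) → Flow σ N, ∀ τ : ℝ, 0 < τ →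
  ∀ ϑs ϑ δ : ℝ, ∀ m₀ : ℕ, 0 < ϑs → 0 < ϑ → 0 < δ →
    ∃ c₀ : ℝ, 0 < c₀ ∧ ∀ c : ℝ, c₀ ≤ c → ∃ b₀ : ℝ, 0 < b₀ ∧ ∀ b : ℝ, 0 < b → b ≤ b₀ → ∃ N₀ : ℕ, ∀ N : ℕ, N₀ ≤ N →
    ∫⁻ z, ENNReal.ofReal (unitAvg c σ N τ fun k q =>
        if (∃ x : T3, cellOf c σ N x = q) ∧ (nbhd c σ N ((Φ N).flow ((k : ℝ) * stepLen c σ N) z) q).Nonempty ∧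
            (ϑ < inhom ϑs (binConfig b ((Φ N).flow ((k : ℝ) * stepLen c σ N) z))
                (pop c σ N ((Φ N).flow ((k : ℝ) * stepLen c σ N) z) q)
                (nbhd c σ N ((Φ N).flow ((k : ℝ) * stepLen c σ N) z) q) ∨
              ((pop c σ N ((Φ N).flow ((k : ℝ) * stepLen c σ N) z) q).Nonempty ∧
                (pop c σ N ((Φ N).flow ((k : ℝ) * stepLen c σ N) z) q).card < m₀)) then 1 else 0)
      ∂(localGibbsLaw σ a₀ u₀ θ₀ N (Φ N)) ≤ ENNReal.ofReal δ

/-! ## §R5 The re-typed hypotheses of the transfer architecture (H2_B, H3_W, H5_W) -/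

/-- **H2_B `BadForecastRareB`** — `BadForecastRare` with the binned guard and `∃ b₀ ∀ b ≤ b₀` (discharged from `MesoForecastChaosB`
verbatim at `δ' = δ₂/2`, `L = 54(log 2 + A)/δ₂`, transfer `exists_lgTransferConst`). -/
def BadForecastRareB : Prop :=
  ∃ φs : ℝ, 0 < φs ∧ ∃ σ₁ : ℝ, 0 < σ₁ ∧
  ∀ (a₀ θ₀ : T3 → ℝ) (u₀ : T3 → V3), Continuous a₀ → Continuous θ₀ → Continuous u₀ →
    (∀ x, 0 < a₀ x) → (∀ x, 0 < θ₀ x) →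
  ∀ σ : ℝ, 0 < σ → σ ≤ σ₁ → σ ≤ 1 / 2 → ∀ Φ : (N : ℕ) → Flow σ N, ∀ τ : ℝ, 0 < τ →
  ∀ Ψ : V3 × V3 × V3 → ℝ, Continuous Ψ → (∃ C : ℝ, ∀ p, |Ψ p| ≤ C) →
  ∀ ϑs η δ T δ₂ : ℝ, 0 < ϑs → 0 < η → 0 < δ → 0 < T → 0 < δ₂ →
  ∃ ϑ : ℝ, 0 < ϑ ∧ ∃ c₀ : ℝ, 0 < c₀ ∧ ∀ c : ℝ, c₀ ≤ c → ∃ b₀ : ℝ, 0 < b₀ ∧ ∀ b : ℝ, 0 < b → b ≤ b₀ →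
  ∃ N₀ : ℕ, ∀ N : ℕ, N₀ ≤ N →
    unitMean c σ N τ (localGibbsLaw σ a₀ u₀ θ₀ N (Φ N)) (fun k q z =>
      if GoodUnitB b ϑs ϑ φs c σ N ((Φ N).flow ((k : ℝ) * stepLen c σ N) z) q ∧
          δ < gForecast b c σ N (Φ N) (badWeight Ψ η T c σ N (Φ N)) k q z
      then 1 else 0) ≤ δ₂

/-- **H3_W `NonGoodRareW`** — the COLLISION-WEIGHTED mass of occupied non-good (binned) units is small under the evolved law: the
`LG`-mean of the unit average of `Jng (k, q) · min(ownedCount (k,q), T)` is `≤ δ₃` (on the good set `Jng = 𝟙{occupied ∧ ¬GoodUnitB}`;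
discharged from `CoarseLocalMaxwellianityW` for the non-Maxwellian part and `T ×` the FRACTIONS of `LocalCountUI` (ii) /
`NoKineticIrregularityB` for the packed and the inhomogeneous parts — weights are `≤ T`, no uniform integrability needed). -/
def NonGoodRareW : Prop :=
  ∀ φs : ℝ, 0 < φs →
  ∀ (a₀ θ₀ : T3 → ℝ) (u₀ : T3 → V3), Continuous a₀ → Continuous θ₀ → Continuous u₀ →
    (∀ x, 0 < a₀ x) → (∀ x, 0 < θ₀ x) →
  ∃ σ₀ : ℝ, 0 < σ₀ ∧ ∀ σ : ℝ, 0 < σ → σ < σ₀ → ∀ Φ : (N : ℕ) → Flow σ N, ∀ τ : ℝ, 0 < τ →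
  ∀ ϑs ϑ δ₃ T : ℝ, 0 < ϑs → 0 < ϑ → 0 < δ₃ → 0 < T →
  ∃ c₀ : ℝ, 0 < c₀ ∧ ∀ c : ℝ, c₀ ≤ c → ∃ b₀ : ℝ, 0 < b₀ ∧ ∀ b : ℝ, 0 < b → b ≤ b₀ → ∃ N₀ : ℕ, ∀ N : ℕ, N₀ ≤ N →
    unitMean c σ N τ (localGibbsLaw σ a₀ u₀ θ₀ N (Φ N)) (fun k q z =>
      Jng b ϑs ϑ φs c σ N (Φ N) k q z * min (ownedCount c σ N (Φ N) k q z) T) ≤ δ₃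

/-- **H5_W `ForecastSplitW`** — the WEIGHTED per-unit split of one `N` (no limits, no mechanism; replaces `ForecastAlgebra` (iii)):
for continuous positive profiles, `0 < σ < 1/2`, every `N`, flow, horizon, bounded continuous `Ψ`, `η', T, c, b > 0`, `ϑs, ϑ, φs` and
`δ > 0`, with `LG = localGibbsLaw …`, `Ĝ = gForecast b c σ N Φ`, `J = Jng b ϑs ϑ φs c σ N Φ`, `bW' = badWeight Ψ η' T`:
(1) for revealed, box-supported, `[0,T]`-valued `X, R` with `X ≤ bW' + R` on `Φ.good`:
`m(Ĝ X) ≤ m(Ĝ (J·X)) + δ · h³ · #cellBox h + T · m(𝟙{GoodUnitB ∧ δ < Ĝ bW'}) + m(Ĝ R)` — pointwise a.e.: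
`Ĝ X = J·Ĝ X + (1−J)·Ĝ X`, `J·Ĝ X = Ĝ(J·X)` (`J` is `σ(seqHist k q)`-measurable: pull-in, `G_N`-a.e., transported to `LG`-a.e. by
`LG ≪ G_N`), `(1−J)·Ĝ X ≤ (1−J)(Ĝ bW' + Ĝ R)` (monotone / additive `condExp`, `LG(goodᶜ) = 0`), and on `{J = 0}` either the cell is
EMPTY at `kΔ` (then `Ĝ bW' = 0` a.e.: pull-out of a revealed null event) or it is binned-GOOD (then `Ĝ bW' ≤ δ + T·𝟙{δ < Ĝ bW'}` as
`0 ≤ Ĝ bW' ≤ T` a.e.);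
(2) for the same `X, R`: `m(J·X) ≤ m(J·min(ownedCount, T)) + m(R)` — on `Φ.good`, `bW' ≤ min(ownedCount, T)` and `0 ≤ J ≤ 1`. -/
def ForecastSplitW : Prop :=
  ∀ (a₀ θ₀ : T3 → ℝ) (u₀ : T3 → V3), Continuous a₀ → Continuous θ₀ → Continuous u₀ →
    (∀ x, 0 < a₀ x) → (∀ x, 0 < θ₀ x) →
  ∀ σ : ℝ, 0 < σ → σ < 1 / 2 → ∀ (N : ℕ) (Φ : Flow σ N) (τ : ℝ), 0 < τ →
  ∀ Ψ : V3 × V3 × V3 → ℝ, Continuous Ψ → (∃ C : ℝ, ∀ p, |Ψ p| ≤ C) →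
  ∀ η' T c b : ℝ, 0 < η' → 0 < T → 0 < c → 0 < b → ∀ ϑs ϑ φs δ : ℝ, 0 < δ →
  ∀ X R : ℕ → Cell → Phase N → ℝ,
    (∀ k q z, 0 ≤ X k q z ∧ X k q z ≤ T) → (∀ k q z, 0 ≤ R k q z ∧ R k q z ≤ T) →
    (∀ k, ∀ q ∉ cellBox (c * meanFreePath σ N), X k q = fun _ => 0) →
    (∀ k, ∀ q ∉ cellBox (c * meanFreePath σ N), R k q = fun _ => 0) →
    (∀ k q, q ∈ cellBox (c * meanFreePath σ N) → ∀ z z',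
      seqHistLE b c σ N Φ k q z = seqHistLE b c σ N Φ k q z' → X k q z = X k q z') →
    (∀ k q, q ∈ cellBox (c * meanFreePath σ N) → ∀ z z',
      seqHistLE b c σ N Φ k q z = seqHistLE b c σ N Φ k q z' → R k q z = R k q z') →
    (∀ k q, ∀ z ∈ Φ.good, X k q z ≤ badWeight Ψ η' T c σ N Φ k q z + R k q z) →
    unitMean c σ N τ (localGibbsLaw σ a₀ u₀ θ₀ N Φ) (gForecast b c σ N Φ X) ≤
        unitMean c σ N τ (localGibbsLaw σ a₀ u₀ θ₀ N Φ)
            (gForecast b c σ N Φ fun k q z => Jng b ϑs ϑ φs c σ N Φ k q z * X k q z) +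
          δ * ((c * meanFreePath σ N) ^ 3 * (cellBox (c * meanFreePath σ N)).card) +
          T * unitMean c σ N τ (localGibbsLaw σ a₀ u₀ θ₀ N Φ) (fun k q z =>
            if GoodUnitB b ϑs ϑ φs c σ N (Φ.flow ((k : ℝ) * stepLen c σ N) z) q ∧
                δ < gForecast b c σ N Φ (badWeight Ψ η' T c σ N Φ) k q z
            then 1 else 0) +
          unitMean c σ N τ (localGibbsLaw σ a₀ u₀ θ₀ N Φ) (gForecast b c σ N Φ R) ∧
      unitMean c σ N τ (localGibbsLaw σ a₀ u₀ θ₀ N Φ) (fun k q z => Jng b ϑs ϑ φs c σ N Φ k q z * X k q z) ≤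
        unitMean c σ N τ (localGibbsLaw σ a₀ u₀ θ₀ N Φ)
            (fun k q z => Jng b ϑs ϑ φs c σ N Φ k q z * min (ownedCount c σ N Φ k q z) T) +
          unitMean c σ N τ (localGibbsLaw σ a₀ u₀ θ₀ N Φ) R

/-! ## §R6 Pointwise sanity -/

/-- The weighted summand is dominated by `T` times the unweighted indicator. [folklore] -/
theorem weighted_le_T_mul {P : Prop} [Decidable P] (w T : ℝ) :
    (if P then (1 : ℝ) else 0) * min w T ≤ T * (if P then (1 : ℝ) else 0) := by
  split_ifs
  · simp only [one_mul, mul_one]; exact min_le_right w T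
  · simp

/-- The weighted summand is nonnegative when the weight is. [folklore] -/
theorem weighted_nonneg {P : Prop} [Decidable P] {w T : ℝ} (hw : 0 ≤ w) (hT : 0 ≤ T) :
    0 ≤ (if P then (1 : ℝ) else 0) * min w T := by
  split_ifs
  · simpa using le_min hw hT
  · simp

end Summit.AtomisticToContinuum.HydrodynamicLimit.Theorems.EquilibriumForecastLine

end
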